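import Mathlib.Data.Int.Basic
import Summits.Ventures.PackingBounds.Energy.EightPointCkFourGramD
import Summits.Ventures.PackingBounds.Energy.NFGramPSDRows
import HarnessLib

/-!
# Witness facts for block SOS: yD = lD lDᵀ + eD, margin 258860425819491

Framing: lottery ticket; floor = certified bounds/negative ranges. Venture `PackingBounds`, cell `pub-packcert`, energy family E3PT (pub-packcert-energy gen 22;
KERNEL-NF data route, generator `code/e3pt/g22/nfkernel/nfgram_emit.py`). Source certificate `pub-packcert-energy/certs/e3pt/e3pt-sharp-n3N8ck4d6F-none.json`, block `SOS` (r = 63),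
field degree 3 (ξ enclosed by 349702709 ≤ 2^30·ξ ≤ 349702710).
-/

namespace Summit.Ventures.PackingBounds.Energy.EightPointCkFour

set_option maxRecDepth 100000
set_option maxHeartbeats 0
open Summit.Ventures.PackingBounds.Energy

/-- Rows 0 ≤ i < 16 of `yD = lD lDᵀ + eD` (kernel evaluation). -/
theorem rowsS_0 : GramData.checkRows 63 63 0 16 yDS lDS eDS = true := by decide +kernel

/-- Rows 16 ≤ i < 32 of `yD = lD lDᵀ + eD` (kernel evaluation). -/
theorem rowsS_1 : GramData.checkRows 63 63 16 32 yDS lDS eDS = true := by decide +kernel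

/-- Rows 32 ≤ i < 48 of `yD = lD lDᵀ + eD` (kernel evaluation). -/
theorem rowsS_2 : GramData.checkRows 63 63 32 48 yDS lDS eDS = true := by decide +kernel

/-- Rows 48 ≤ i < 63 of `yD = lD lDᵀ + eD` (kernel evaluation). -/
theorem rowsS_3 : GramData.checkRows 63 63 48 63 yDS lDS eDS = true := by decide +kernel

/-- Diagonal dominance of eD with margin 258860425819491. -/
theorem ddS : GramData.checkDDm 63 258860425819491 eDS = true := by decide +kernel

end Summit.Ventures.PackingBounds.Energy.EightPointCkFour
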